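import Summits.BirchSwinnertonDyer.BirchSwinnertonDyer.Theorems.Rank2Observatory2DescClTDescent
import Summits.BirchSwinnertonDyer.BirchSwinnertonDyer.Theorems.Rank2Observatory2DescClValuation
import Summits.BirchSwinnertonDyer.BirchSwinnertonDyer.Theorems.Rank2Observatory2DescPIDCertB
import HarnessLib

/-!
# KERNEL-2DESC-CL (N6c): class-group generation certificates relative to the `q`-support subgroup

HONEST FRAMING: per-curve certified theorems and census instruments; no claim on BSD in rank ≥ 2.

For the class-group-general kernel 2-descent (`TwoDescCl.mordellWeilRank_le_of_coverSet_cl`) the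
hypothesis `hgen` asks that the classes of the ideals containing `M` generate the class group.  With
`M = F′(θ)·q` for one auxiliary rational prime `q` it suffices (N6 `closure_tsupp_eq_top_of_dvd`)
to certify this for the subgroup

  `H_q = closure {[J] : q ∈ J}`.

This file packages the FIELD-LEVEL certificate: a Minkowski sweep (`classGroup_eq_top_of_classIn`
with the explicit cubic bound `64·|Δ(F)| < 799·b²` of cert-3's `minkowskiBound_lt`) in which every
prime `P` below the bound is discharged either because it contains `q`, or by a RELATION
CERTIFICATE `β ∈ P`, `|N(β)| = N(P)·q^j` (then `(β) = P·J` with `N(J) = q^j`, so every prime factor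
of `J` contains `q`).

References: Marcus, *Number Fields*, Ch. 5 Thm. 35, Thm. 37 and Cor. 2; Cohen, *A Course in
Computational Algebraic Number Theory*, §6.5 (class group computation from relations).
-/

-- single-conjunct summit: `Summit.BirchSwinnertonDyer.BirchSwinnertonDyer.…` repeats the name by design
set_option linter.dupNamespace false

noncomputable section

open scoped NumberField nonZeroDivisors

namespace Summit.BirchSwinnertonDyer.BirchSwinnertonDyer.Rank2Observatory.TwoDescCl

open IsDedekindDomain IsDedekindDomain.HeightOneSpectrum NumberField Ideal Polynomial Module
open Literature.NumberTheory.NumberFields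

variable {K : Type*} [Field K] [NumberField K]

/-- **Primes of `q`-power norm lie in `H_q`.** If `P` is a non-zero prime with `N(P) ∣ q ^ j`
then `q ∈ P`, so the class of `P` lies in the subgroup generated by the classes of the ideals
containing `q`. [cite: Marcus2018, Ch. 3, Thm. 22] -/
theorem classIn_tsupp_of_absNorm_dvd_pow {q : ℕ} (hq : q.Prime) {j : ℕ} (P : Ideal (𝓞 K))
    (hP : P.IsPrime) (hP0 : P ≠ ⊥) (h : absNorm P ∣ q ^ j) :
    ClassIn (Subgroup.closure {c : ClassGroup (𝓞 K) | ∃ (J : Ideal (𝓞 K))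
      (hJ : J ∈ (Ideal (𝓞 K))⁰), ((q : ℕ) : 𝓞 K) ∈ J ∧ ClassGroup.mk0 ⟨J, hJ⟩ = c}) P := by
  obtain ⟨i, -, hi⟩ := (Nat.dvd_prime_pow hq).mp h
  have hi0 : i ≠ 0 := by
    rintro rfl
    have h1 := one_lt_absNorm hP hP0
    rw [hi, pow_zero] at h1
    exact lt_irrefl _ h1
  have hqdvd : q ∣ absNorm P := by rw [hi]; exact dvd_pow_self q hi0
  have hmem : ((q : ℕ) : 𝓞 K) ∈ P :=
    natCast_mem_of_dvd_absNorm ⟨P, hP, hP0⟩ hq hqdvd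
  exact classIn_closure_of_mem hmem

/-- **Relation certificate.** If `β ∈ P` (a non-zero prime) has `|N(β)| = N(P) · q ^ j` for the
auxiliary prime `q`, then the class of `P` lies in `H_q` (indeed `(β) = P · J` with `N(J) = q^j`).
[cite: Marcus2018, Ch. 5, Thm. 35] -/
theorem classIn_tsupp_of_rel {q : ℕ} (hq : q.Prime) {P : Ideal (𝓞 K)}
    (hP0 : P ≠ ⊥) {β : 𝓞 K} (hβ : β ∈ P) (j : ℕ)
    (hnorm : (Algebra.norm ℤ β).natAbs = absNorm P * q ^ j) :
    ClassIn (Subgroup.closure {c : ClassGroup (𝓞 K) | ∃ (J : Ideal (𝓞 K))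
      (hJ : J ∈ (Ideal (𝓞 K))⁰), ((q : ℕ) : 𝓞 K) ∈ J ∧ ClassGroup.mk0 ⟨J, hJ⟩ = c}) P :=
  ClassIn.of_mem_of_absNorm hP0 hβ (pow_pos hq.pos j) hnorm
    fun Q hQ hQ0 hdvd => classIn_tsupp_of_absNorm_dvd_pow hq Q hQ hQ0 hdvd

/-- **Relation certificate for a presented prime** `P = (p, G(θ))` of known norm `p ^ f`:
membership `β = x·p + y·G(θ) ∈ P` by coefficients and `|N(β)| = p^f · q^j`. [cite: Marcus2018, Ch. 5, Thm. 35] -/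
theorem classIn_tsupp_span_pair_of_rel {q : ℕ} (hq : q.Prime) {p : ℕ} {g : 𝓞 K}
    (hP0 : span {(p : 𝓞 K), g} ≠ ⊥) {f : ℕ}
    (habs : absNorm (span {(p : 𝓞 K), g}) = p ^ f) (x y β : 𝓞 K) (hβ : x * p + y * g = β)
    (j : ℕ) (hnorm : (Algebra.norm ℤ β).natAbs = p ^ f * q ^ j) :
    ClassIn (Subgroup.closure {c : ClassGroup (𝓞 K) | ∃ (J : Ideal (𝓞 K))
      (hJ : J ∈ (Ideal (𝓞 K))⁰), ((q : ℕ) : 𝓞 K) ∈ J ∧ ClassGroup.mk0 ⟨J, hJ⟩ = c})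
      (span {(p : 𝓞 K), g}) := by
  refine classIn_tsupp_of_rel hq hP0 (β := β) ?_ j (by rw [hnorm, habs])
  exact Ideal.mem_span_pair.mpr ⟨x, y, hβ⟩

/-- **A prime containing `q` lies in `H_q`** (presented form). [folklore] -/
theorem classIn_tsupp_span_pair_self (q : ℕ) (g : 𝓞 K) :
    ClassIn (Subgroup.closure {c : ClassGroup (𝓞 K) | ∃ (J : Ideal (𝓞 K))
      (hJ : J ∈ (Ideal (𝓞 K))⁰), ((q : ℕ) : 𝓞 K) ∈ J ∧ ClassGroup.mk0 ⟨J, hJ⟩ = c})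
      (span {(q : 𝓞 K), g}) :=
  classIn_closure_of_mem (Ideal.subset_span (by simp))

/-- **Degree guard.** A prime `P` above `p` of norm `p ^ f` with `b ≤ p ^ f` is outside the sweep
range `p ^ {f_P} < b`. [folklore] -/
theorem not_pow_inertiaDeg_lt {p : ℕ} {P : Ideal (𝓞 K)}
    (hP : P ∈ primesOver (span {(p : ℤ)}) (𝓞 K)) {f b : ℕ} (habs : absNorm P = p ^ f)
    (hb : b ≤ p ^ f) : ¬ p ^ P.inertiaDeg ℤ < b := by
  haveI : P.IsPrime := hP.1
  haveI : P.LiesOver (span {(p : ℤ)}) := hP.2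
  have h1 := Ideal.pow_inertiaDeg p P
  rw [habs] at h1
  rw [h1]
  exact not_lt.mpr hb

/-- **Class-group generation below an explicit cubic Minkowski bound.** For a cubic field
`K = ℚ(θ)`, `F(θ) = 0`, and `b` with `64·|Δ(F)| < 799·b²`: if every prime `P` above a rational
prime `p < b` with `p ^ {f_P} < b` has `ClassIn H P`, then `H` is the whole class group.
[cite: Marcus2018, Ch. 5, Cor. 2 of Thm. 37] -/
theorem eq_top_of_classIn_lt {A B C : ℤ} {θ : K} (hirr : Irreducible (MonicCubic.polyQ A B C))
    (hθ : aeval θ (MonicCubic.poly A B C) = 0) (h3 : finrank ℚ K = 3) {b : ℕ}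
    (hd : 64 * |MonicCubic.disc A B C| < 799 * (b : ℤ) ^ 2) {H : Subgroup (ClassGroup (𝓞 K))}
    (h : ∀ p : ℕ, p < b → p.Prime → ∀ P ∈ primesOver (span {(p : ℤ)}) (𝓞 K),
      p ^ P.inertiaDeg ℤ < b → ClassIn H P) : H = ⊤ := by
  have hdK : 64 * |discr K| < 799 * (b : ℤ) ^ 2 :=
    lt_of_le_of_lt (by linarith [TwoDescCubic.abs_discr_le_abs_disc hirr hθ h3]) hd
  have hM := TwoDescCubic.minkowskiBound_lt h3 hdK
  have hfloor : ⌊(4 / Real.pi) ^ InfinitePlace.nrComplexPlaces K *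
      ((finrank ℚ K).factorial / (finrank ℚ K : ℝ) ^ finrank ℚ K * √|(discr K : ℝ)|)⌋₊ < b := by
    refine (Nat.floor_lt (by positivity)).mpr ?_
    exact_mod_cast hM
  refine classGroup_eq_top_of_classIn fun p hp hprime P hP hle => ?_
  have hpb : p < b := lt_of_le_of_lt (Finset.mem_Icc.mp hp).2 hfloor
  exact h p hpb hprime P hP (lt_of_le_of_lt hle hfloor)

end Summit.BirchSwinnertonDyer.BirchSwinnertonDyer.Rank2Observatory.TwoDescCl
end
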